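import Mathlib
import Summits.NavierStokesRegularity.NavierStokesRegularity.Theorems.FilamentSkeletonRssTorqueMultiplierODE

/-!
# Route `FilamentSkeletonRss` · crux `SelectionBoxRJ` (stmt-NavierStokesRegularity-21220) — TORQUE SELECTION LEMMA
# (by-name PORT of ns-idea-12 g2's sorry-free deposit `Cruxes/SelectionBoxRJ/Lines/torque_selection.lean`)

AUTHOR OF THE MATHEMATICS AND OF THE LEAN TEXT: seat `ns-idea-12` g2 (planner-ns-idea-12-g2-0, D-0145 ideator), 2026-08-28,
file `Cruxes/SelectionBoxRJ/Lines/torque_selection.lean` (commit c284d5f603b3, sha16 ee747623e2523c39; card `torque_selection.md`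
6e42142203e92c6a, evidence #59 on stmt-21220), endorsed by the critic of record idea-crit-7 g2 (08:14:14Z, recommendation (4)).
PORTED into `Theorems/` BY NAME — statements and proofs byte-identical, only the namespace changes
(`…Theorems.TorqueSelection.X` here vs `…Cruxes.SelectionBoxRJ.TorqueSelection.X` there) — by the filament lane
`ns-filament-19175-p1` g10 on director-ns dss_61 (1)(a) / dss_64 (1) («do NOT re-derive: PORT that file's theorems BY NAME into
`Theorems/…`, `--supports stmt-NavierStokesRegularity-21220 --as helper`, author credit ns-idea-12 g2»), so that the lemma is
IMPORTABLE (a `Theorems/` or `Literature/` file may not import a `Cruxes/…/Lines/` workfile).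

CONTENT (ns-idea-12 g2's module docstring, verbatim): «In the m = 0 (torque) layer of the filament-skeleton profile equation, the
disc-integrated binormal torque `q(s)` of an admissible (confined, bounded) correction along the filament arclength `s` obeys,
after the flat-cokernel reduction, `q′(s) = w′·s·q(s) − B·e^{−s²}` with `w′ > 0` the axial strain rate at the corner and `B` the
binormal (Local-Induction) coefficient that the route's STRICT `SignLaw` wants to read with a definite sign. THIS FILE PROVES
(sorry-free, Mathlib only): a solution bounded on `ℝ` forces `B = 0` (and then `q ≡ 0` is the only bounded solution).
Consequence recorded in the memo: every sign law of this type is satisfiable only vacuously — the selection layer needs the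
torque lemma, not a sign (retype request R-T, director's call). Proof: the integrating factor `φ(s) = q(s)·e^{−w′s²/2}` has
`φ′ = −B·e^{−(1+w′/2)s²}` of constant sign and `φ → 0` at `±∞` (boundedness of `q`); a strictly monotone function cannot have
the same limit at both ends.»
* `hasDerivAt_integratingFactor`, `tendsto_gaussWeight`, **`torqueODE_forces_zero`**, `torqueODE_bounded_solution_eq_zero`.

RELATION TO THE LANE'S OWN FILE (landed 08:26Z, before dss_64 was read — independent route through the Gaussian integral):
`…Theorems/FilamentSkeletonRssTorqueMultiplierODE.lean` (p616918, namespace `…Theorems.TorqueBudget`) states the same lemma in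
`HasDerivAt` form (`TorqueBudget.torqueMultiplier_eq_zero`, `TorqueBudget.torque_solution_eq_zero`) together with the general
flat-weight solvability `∫φF = 0` and the quantitative bound `|B|√(π/(1+w/2)) ≤ ∫|e^{−ws²/2}·remainder|`; the last section of
this file records the one-line bridges `deriv`-form ↔ `HasDerivAt`-form (`torqueODE_forces_zero_of_hasDerivAt`,
`torqueMultiplier_eq_zero_of_deriv`) so that either name can be cited.

HONEST FRAMING (author's words): «No Navier–Stokes / summit statement is proved or refuted by this lemma; 21220 stays OPEN as
typed.»  MODEL-rung bookkeeping; NS regularity OPEN.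
-/

set_option linter.dupNamespace false

namespace Summit.NavierStokesRegularity.NavierStokesRegularity.Theorems.TorqueSelection

open Filter Topology


/-- Derivative of the integrating-factor transform `φ(s) = q(s)·e^{−(w′/2)s²}` along the torque ODE. (statement and proof VERBATIM from ns-idea-12 g2's `Cruxes/SelectionBoxRJ/Lines/torque_selection.lean`, sha16 ee747623e2523c39; ported by name per director-ns dss_64) [folklore] -/
theorem hasDerivAt_integratingFactor {w' B : ℝ} {q : ℝ → ℝ} (hq : Differentiable ℝ q)
    (hODE : ∀ s, deriv q s = w' * s * q s - B * Real.exp (-s ^ 2)) (s : ℝ) :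
    HasDerivAt (fun x => q x * Real.exp (-(w' / 2) * x ^ 2))
      (-B * (Real.exp (-s ^ 2) * Real.exp (-(w' / 2) * s ^ 2))) s := by
  have h1 : HasDerivAt q (deriv q s) s := (hq s).hasDerivAt
  have h2 : HasDerivAt (fun x : ℝ => -(w' / 2) * x ^ 2) (-(w' / 2) * (2 * s)) s := by
    simpa using (hasDerivAt_pow 2 s).const_mul (-(w' / 2))
  have h3 : HasDerivAt (fun x : ℝ => Real.exp (-(w' / 2) * x ^ 2))
      (Real.exp (-(w' / 2) * s ^ 2) * (-(w' / 2) * (2 * s))) s := h2.exp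
  refine (h1.mul h3).congr_deriv ?_
  rw [hODE s]
  ring

/-- The Gaussian weight `M·e^{−(w′/2)s²}` tends to `0` at `+∞` for `w′ > 0`. (statement and proof VERBATIM from ns-idea-12 g2's `Cruxes/SelectionBoxRJ/Lines/torque_selection.lean`, sha16 ee747623e2523c39; ported by name per director-ns dss_64) [folklore] -/
theorem tendsto_gaussWeight {w' : ℝ} (hw : 0 < w') (M : ℝ) :
    Tendsto (fun s : ℝ => M * Real.exp (-(w' / 2) * s ^ 2)) atTop (𝓝 0) := by
  have hpow : Tendsto (fun s : ℝ => (w' / 2) * s ^ 2) atTop atTop :=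
    (tendsto_pow_atTop two_ne_zero).const_mul_atTop (by positivity)
  have hneg : Tendsto (fun s : ℝ => -(w' / 2) * s ^ 2) atTop atBot := by
    refine (tendsto_neg_atTop_atBot.comp hpow).congr (fun s => ?_)
    simp only [Function.comp_apply]
    ring
  have hexp0 : Tendsto (fun s : ℝ => Real.exp (-(w' / 2) * s ^ 2)) atTop (𝓝 0) :=
    Real.tendsto_exp_atBot.comp hneg
  simpa using hexp0.const_mul M

/-- **Torque selection lemma.** If `w′ > 0`, `q : ℝ → ℝ` is differentiable with `q′(s) = w′ s q(s) − B e^{−s²}` for all `s`,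
and `q` is bounded on `ℝ`, then `B = 0`. (statement and proof VERBATIM from ns-idea-12 g2's `Cruxes/SelectionBoxRJ/Lines/torque_selection.lean`, sha16 ee747623e2523c39; ported by name per director-ns dss_64) [folklore] -/
theorem torqueODE_forces_zero {w' B : ℝ} (hw : 0 < w') {q : ℝ → ℝ} (hq : Differentiable ℝ q)
    (hODE : ∀ s, deriv q s = w' * s * q s - B * Real.exp (-s ^ 2)) (hbdd : ∃ M, ∀ s, |q s| ≤ M) :
    B = 0 := by
  obtain ⟨M, hM⟩ := hbdd
  set φ : ℝ → ℝ := fun s => q s * Real.exp (-(w' / 2) * s ^ 2) with hφdef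
  have hderiv : ∀ s, HasDerivAt φ (-B * (Real.exp (-s ^ 2) * Real.exp (-(w' / 2) * s ^ 2))) s :=
    fun s => hasDerivAt_integratingFactor hq hODE s
  have hderiv' : ∀ s, deriv φ s = -B * Real.exp (-(1 + w' / 2) * s ^ 2) := by
    intro s
    rw [(hderiv s).deriv, ← Real.exp_add]
    congr 1
    ring
  have hMexp := tendsto_gaussWeight hw M
  have hT1 : Tendsto φ atTop (𝓝 0) := by
    refine squeeze_zero_norm (fun s => ?_) hMexp
    rw [Real.norm_eq_abs, hφdef]
    dsimp only
    rw [abs_mul, abs_of_pos (Real.exp_pos _)]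
    exact mul_le_mul_of_nonneg_right (hM s) (Real.exp_pos _).le
  have hT2 : Tendsto (fun s => φ (-s)) atTop (𝓝 0) := by
    refine squeeze_zero_norm (fun s => ?_) hMexp
    rw [Real.norm_eq_abs, hφdef]
    dsimp only
    rw [abs_mul, abs_of_pos (Real.exp_pos _), neg_sq]
    exact mul_le_mul_of_nonneg_right (hM (-s)) (Real.exp_pos _).le
  rcases lt_trichotomy B 0 with hB | hB | hB
  · have hmono : StrictMono φ := by
      refine strictMono_of_deriv_pos (fun s => ?_)
      rw [hderiv' s]
      have := Real.exp_pos (-(1 + w' / 2) * s ^ 2)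
      nlinarith
    have h1 : φ 1 ≤ 0 :=
      ge_of_tendsto hT1 (Filter.eventually_atTop.2 ⟨1, fun c hc => hmono.monotone hc⟩)
    have h2 : 0 ≤ φ (-1) :=
      le_of_tendsto hT2 (Filter.eventually_atTop.2 ⟨1, fun c hc => hmono.monotone (by linarith)⟩)
    have h3 : φ (-1) < φ 1 := hmono (by norm_num)
    linarith
  · exact hB
  · have hanti : StrictAnti φ := by
      refine strictAnti_of_deriv_neg (fun s => ?_)
      rw [hderiv' s]
      have := Real.exp_pos (-(1 + w' / 2) * s ^ 2)
      nlinarith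
    have h1 : 0 ≤ φ 1 :=
      le_of_tendsto hT1 (Filter.eventually_atTop.2 ⟨1, fun c hc => hanti.antitone hc⟩)
    have h2 : φ (-1) ≤ 0 :=
      ge_of_tendsto hT2 (Filter.eventually_atTop.2 ⟨1, fun c hc => hanti.antitone (by linarith)⟩)
    have h3 : φ 1 < φ (-1) := hanti (by norm_num)
    linarith

/-- Corollary: the bounded solution is identically zero (`B = 0` makes `q·e^{−(w′/2)s²}` constant with limit `0`). (statement and proof VERBATIM from ns-idea-12 g2's `Cruxes/SelectionBoxRJ/Lines/torque_selection.lean`, sha16 ee747623e2523c39; ported by name per director-ns dss_64) [folklore] -/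
theorem torqueODE_bounded_solution_eq_zero {w' B : ℝ} (hw : 0 < w') {q : ℝ → ℝ} (hq : Differentiable ℝ q)
    (hODE : ∀ s, deriv q s = w' * s * q s - B * Real.exp (-s ^ 2)) (hbdd : ∃ M, ∀ s, |q s| ≤ M) :
    ∀ s, q s = 0 := by
  have hB : B = 0 := torqueODE_forces_zero hw hq hODE hbdd
  subst hB
  obtain ⟨M, hM⟩ := hbdd
  set φ : ℝ → ℝ := fun s => q s * Real.exp (-(w' / 2) * s ^ 2) with hφdef
  have hderiv : ∀ s, HasDerivAt φ 0 s := fun s =>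
    (hasDerivAt_integratingFactor hq hODE s).congr_deriv (by ring)
  have hdiff : Differentiable ℝ φ := fun s => (hderiv s).differentiableAt
  have hconst : ∀ s, φ s = φ 0 := fun s =>
    is_const_of_deriv_eq_zero hdiff (fun x => (hderiv x).deriv) s 0
  have hT1 : Tendsto φ atTop (𝓝 0) := by
    refine squeeze_zero_norm (fun s => ?_) (tendsto_gaussWeight hw M)
    rw [Real.norm_eq_abs, hφdef]
    dsimp only
    rw [abs_mul, abs_of_pos (Real.exp_pos _)]
    exact mul_le_mul_of_nonneg_right (hM s) (Real.exp_pos _).le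
  have hφ0 : φ 0 = 0 := by
    have hc : Tendsto (fun _ : ℝ => φ 0) atTop (𝓝 0) := hT1.congr (fun s => hconst s)
    exact tendsto_nhds_unique tendsto_const_nhds hc
  intro s
  have hs : q s * Real.exp (-(w' / 2) * s ^ 2) = 0 := (hconst s).trans hφ0
  exact (mul_eq_zero.1 hs).resolve_right (Real.exp_pos _).ne'


/-! ### Bridges to the lane's `HasDerivAt`-form statements (`…Theorems.TorqueBudget`, p616918) -/

/-- `deriv`-form ⇒ `HasDerivAt`-form: ns-idea-12's hypotheses give the hypothesis of
`TorqueBudget.torqueMultiplier_eq_zero`, so the two names prove the same fact. [folklore] -/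
theorem hasDerivAt_of_deriv_form {w' B : ℝ} {q : ℝ → ℝ} (hq : Differentiable ℝ q)
    (hODE : ∀ s, deriv q s = w' * s * q s - B * Real.exp (-s ^ 2)) (s : ℝ) :
    HasDerivAt q (w' * s * q s - B * Real.exp (-(s ^ 2))) s := by
  have h := (hq s).hasDerivAt
  rw [hODE s] at h
  exact h

/-- The torque selection lemma via the lane's Gaussian-integral route (same statement as `torqueODE_forces_zero`,
second proof through `TorqueBudget.torqueMultiplier_eq_zero`). [folklore] -/
theorem torqueODE_forces_zero_of_hasDerivAt {w' B : ℝ} (hw : 0 < w') {q : ℝ → ℝ} (hq : Differentiable ℝ q)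
    (hODE : ∀ s, deriv q s = w' * s * q s - B * Real.exp (-s ^ 2)) (hbdd : ∃ M, ∀ s, |q s| ≤ M) :
    B = 0 :=
  TorqueBudget.torqueMultiplier_eq_zero hw (hasDerivAt_of_deriv_form hq hODE) hbdd

/-- `HasDerivAt`-form ⇒ `deriv`-form: the lane's hypothesis gives ns-idea-12's, so `torqueODE_forces_zero` applies to it. [folklore] -/
theorem torqueMultiplier_eq_zero_of_deriv {w' B : ℝ} (hw : 0 < w') {q : ℝ → ℝ}
    (hq : ∀ s, HasDerivAt q (w' * s * q s - B * Real.exp (-(s ^ 2))) s) (hbdd : ∃ M, ∀ s, |q s| ≤ M) :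
    B = 0 :=
  torqueODE_forces_zero hw (fun s => (hq s).differentiableAt) (fun s => (hq s).deriv) hbdd

end Summit.NavierStokesRegularity.NavierStokesRegularity.Theorems.TorqueSelection
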